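import Summits.QuantumFields.BalabanUV.T4Continuum.Support.DirichletHoleFilling

/-!
# `BalabanUV.T4Continuum.Support.DirichletMorreyDecay` — NE2 (node U1a) formalisation swarm, sub-row `T4-U1a.S-NE2-D1-DIRICHLET°`,
# supplier item «Δ1-HOLEFILL» (brick H-C, part 2 of 2): MORREY DECAY OF THE DIRICHLET ENERGY AT A CORNER OF A VANISHING BLOCK — the
# hole-filling step iterated over dyadic concentric cubes: `E(cube of side 4m) ≤ θ_d^J·(E(cube of side 4·2^J·m) + source)`
# (unit b2b-balaban-t4-ne2-formalise-leaf-08, gen 6, file 5)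

HONEST FRAMING.  Rung (B)+1 bookkeeping at MODEL level (finite torus, one lattice field); [folklore] lattice De Giorgi–Widman; NE2 (U1a) is
NOT proved by this file; spine PROVED 0/9 unchanged; NOT infinite volume, NOT the mass gap, NOT Clay.  HONEST DEPENDENCY (verbatim):
«continuum YM on T⁴ ⇐ BetaPertH ∧ nine spine estimates (0/9 proved); BetaPertH ⇐ (D1) ∧ (D4) ∧ CAP+tail; G-an2-4 gates asym, D1 and NE2/3/4.»

WHAT THIS FILE PROVES (0 sorry).
 * §1 the DYADIC RE-CENTRING: the embedding `emb k j' = k + j'` of the coordinate cube of side `2k` onto the inner cube `[k,3k)^d` of the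
   cube of side `4k`; `chart b (emb k j') = chart (shift k b) j'`; the Dirichlet form of `z` over the small chart IS `dirOn (inner k)` of the
   big chart (`dirOn_shift`), plain sums over the small chart are at most those over the big chart (`sum_shift_le`), and the small chart's
   octant lies in the big chart's octant (`emb_mem_oct`) — vanishing is inherited down the scales;
 * §2 **`morrey_decay`**: `d ≥ 2`, `c ≠ 0`, `z` supported in `Ω`, `m ≥ 1`, `4m = n₀ + 1`; for every `J`, `4·2^J·m = n + 1 ≤ N ν`, base point `b`
   with `z ∘ chart b = 0` on the octant `oct (2^J m) σ`:
   `dirOn univ (z ∘ chart (shift (2·2^J·m − 2m) b)) ≤ θ_d^J · (dirOn univ (z ∘ chart b) + 64(1 + 2^d)(2^J m)²/‖c‖⁴·Σ_j ‖(1_ΩΔz)(chart b j)‖²)`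
   (side `4m` cube ⊂ … ⊂ side `4·2^J m` cube, all with the same centre; induction on `J` over `DirichletHoleFilling.hole_filling_step`, the
   geometric source sum closing because `θ_d ≥ ½`).  In energy units (`‖∂z‖² = ‖c‖²·dirOn`, `‖c‖ = ` sites per unit length) and with the
   global bounds of a region Dirichlet solution (`Σ‖∂z‖² ≤ γ′⁻¹‖w‖²`, `Σ_Ω‖Δz‖² ≤ 2(1+(a′γ′⁻¹)²)‖w‖²`, gan24-p2 `DirichletBoxCompression`) this
   is MORREY DECAY `E(z; cube ρ) ≲ (ρ/ρ₀)^{2s_d}·‖w‖²`, `2s_d = log₂ θ_d⁻¹ > 0`, at EVERY vertex of EVERY exterior block of EVERY union of unit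
   blocks, every `d ≥ 2`, every torus.

WHY (memo `t4/T4-EST-NE2-D1-LOCAL.md` §2 ∕ §5).  At the located residue of «Δ1-LOCAL» (conflict patches: the spiral 4-chain, complements of
cube unions at vertex-only ∕ edge-only contacts) no admissible one-sided cutoff exists near the conflict locus; the piece of the field within
`ρ` of the locus must be bounded TRIVIALLY (`‖∂ᴴ∂w‖² ≤ 4‖c‖²E(w)`), which is affordable exactly when the energy there decays like a power of
`ρ`.  This file supplies that power for point loci (cubes); line loci (d = 4 staircases, edge contacts) take the same bricks on cylinders.

ABSOLUTE RULE (cell, verbatim): «No internally-minted statement may enter as a cited fact. Every hypothesis is either kernel-proved in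
this package or a verbatim quotation of a PUBLISHED theorem with page reference. The manuscript(s) under audit are NOT citable for
their own disputed steps — they are the thing under adjudication; programme-internal (2001/route/tribunal) claims are never citable.»
[folklore]; plain data `def`s (`shift`, `emb`, `proj`), no `def … : Prop` fact.  NOT CLAIMED: the assembly H-E/H-F (cutoffs relative to the
conflict locus; the two-level law on conflict patches); the rate is parodic by construction (honest, unoptimised constants); NE2; NE3.
-/

noncomputable section

open scoped BigOperators ComplexConjugate Matrix
open Finset

namespace Summit.QuantumFields.BalabanUV.T4Continuum.DirichletMorreyDecay

open Literature.MathematicalPhysics.QuantumFieldTheory.Balaban1983to89.B5Prop11Plancherel (Tor unitVec)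
open Literature.MathematicalPhysics.QuantumFieldTheory.Balaban1983to89.B5Action121 (sdiff LapS)
open Literature.MathematicalPhysics.QuantumFieldTheory.Balaban1983to89.Beta.CoordCubePoincare (stepUp)
open Summit.QuantumFields.BalabanUV.T4Continuum.DirichletDirectionalBesov (restrictTo)
open Summit.QuantumFields.BalabanUV.T4Continuum.CoordSlabPoincare
open Summit.QuantumFields.BalabanUV.T4Continuum.CoordOctantBoxes (oct mem_oct)
open Summit.QuantumFields.BalabanUV.T4Continuum.CoordAnnulusPoincare (inner mem_inner)
open Summit.QuantumFields.BalabanUV.T4Continuum.DirichletHoleFillingCutoff (chart chart_injective chart_stepUp)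
open Summit.QuantumFields.BalabanUV.T4Continuum.DirichletHoleFilling (theta theta_lt_one hole_filling_step)

variable {d : ℕ} (N : Fin d → ℕ) [hN : ∀ μ, NeZero (N μ)]

/-! ## §1 Dyadic re-centring -/

/-- the diagonal SHIFT of a base point by `t` lattice steps in every direction. [folklore] -/
def shift (t : ℕ) (b : Tor N) : Tor N := b + fun ν => ((t : ℕ) : ZMod (N ν))

omit hN in
/-- shifts compose additively. [folklore] -/
theorem shift_shift (s t : ℕ) (b : Tor N) : shift N s (shift N t b) = shift N (t + s) b := by
  funext ν; simp only [shift, Pi.add_apply, Nat.cast_add]; ring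

omit hN in
/-- `shift 0 = id`. [folklore] -/
theorem shift_zero (b : Tor N) : shift N 0 b = b := by
  funext ν; simp [shift]

section Emb

variable (k : ℕ) {n n' : ℕ}

/-- the EMBEDDING of the small cube (`n' + 1 = 2k` digits) onto the inner cube of the big one (`n + 1 = 4k` digits): `j' ↦ k + j'`. [folklore] -/
def emb (j' : Fin d → Fin (n' + 1)) : Fin d → Fin (n + 1) := fun lam => mkF (n := n) (k + (j' lam : ℕ))

/-- its inverse on the inner cube: `j ↦ j − k`. [folklore] -/
def proj (j : Fin d → Fin (n + 1)) : Fin d → Fin (n' + 1) := fun lam => mkF (n := n') ((j lam : ℕ) - k)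

/-- the digits of `emb`. [folklore] -/
theorem val_emb (hn : 4 * k = n + 1) (hn' : 2 * k = n' + 1) (j' : Fin d → Fin (n' + 1)) (lam : Fin d) :
    ((emb (n := n) k j' lam : Fin (n + 1)) : ℕ) = k + (j' lam : ℕ) := by
  rw [emb, val_mkF_of_lt]; have := (j' lam).isLt; omega

/-- the digits of `proj` on the inner cube. [folklore] -/
theorem val_proj (hn : 4 * k = n + 1) (hn' : 2 * k = n' + 1) {j : Fin d → Fin (n + 1)} (hj : j ∈ inner (n := n) k) (lam : Fin d) :
    ((proj (n' := n') k j lam : Fin (n' + 1)) : ℕ) = (j lam : ℕ) - k := by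
  rw [mem_inner] at hj
  rw [proj, val_mkF_of_lt]; have := hj lam; omega

/-- `emb` lands in the inner cube. [folklore] -/
theorem emb_mem_inner (hn : 4 * k = n + 1) (hn' : 2 * k = n' + 1) (j' : Fin d → Fin (n' + 1)) : emb (n := n) k j' ∈ inner (n := n) k := by
  rw [mem_inner]; intro lam; rw [val_emb k hn hn']; have := (j' lam).isLt; omega

/-- `proj ∘ emb = id`. [folklore] -/
theorem proj_emb (hn : 4 * k = n + 1) (hn' : 2 * k = n' + 1) (j' : Fin d → Fin (n' + 1)) : proj (n' := n') k (emb (n := n) k j') = j' := by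
  funext lam; apply Fin.ext
  rw [val_proj k hn hn' (emb_mem_inner k hn hn' j'), val_emb k hn hn']; omega

/-- `emb ∘ proj = id` on the inner cube. [folklore] -/
theorem emb_proj (hn : 4 * k = n + 1) (hn' : 2 * k = n' + 1) {j : Fin d → Fin (n + 1)} (hj : j ∈ inner (n := n) k) :
    emb (n := n) k (proj (n' := n') k j) = j := by
  have hj' := hj
  rw [mem_inner] at hj'
  funext lam; apply Fin.ext
  rw [val_emb k hn hn', val_proj k hn hn' hj]; have := hj' lam; omega

/-- `emb` commutes with steps off the last layer. [folklore] -/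
theorem emb_stepUp (hn : 4 * k = n + 1) (hn' : 2 * k = n' + 1) {j' : Fin d → Fin (n' + 1)} {ν : Fin d} (hj : j' ν ≠ Fin.last n') :
    emb (n := n) k (stepUp j' ν) = stepUp (emb (n := n) k j') ν := by
  have hne : emb (n := n) k j' ν ≠ Fin.last n := by
    intro h; have h1 := congrArg Fin.val h; rw [Fin.val_last, val_emb k hn hn'] at h1
    have h2 : (j' ν : ℕ) ≠ n' := fun e => hj (Fin.ext (by rw [e, Fin.val_last]))
    have := (j' ν).isLt; omega
  refine ext_of_digit ν ?_ fun l hl => ?_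
  · rw [val_emb k hn hn', val_stepUp hj, val_stepUp hne, val_emb k hn hn']; omega
  · apply Fin.ext; rw [val_emb k hn hn', stepUp_apply_ne _ hl, stepUp_apply_ne _ hl, val_emb k hn hn']

omit hN in
/-- **RE-CENTRING OF THE CHART**: `chart b (emb k j') = chart (shift k b) j'`. [folklore] -/
theorem chart_emb (hn : 4 * k = n + 1) (hn' : 2 * k = n' + 1) (b : Tor N) (j' : Fin d → Fin (n' + 1)) :
    chart N b (emb (n := n) k j') = chart N (shift N k b) j' := by
  funext ν
  simp only [chart, shift, Pi.add_apply, val_emb k hn hn', Nat.cast_add]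
  ring

/-- sums over the small cube are sums over the inner cube of the big one. [folklore] -/
theorem sum_emb (hn : 4 * k = n + 1) (hn' : 2 * k = n' + 1) {β : Type*} [AddCommMonoid β] (g : (Fin d → Fin (n + 1)) → β) :
    ∑ j' : Fin d → Fin (n' + 1), g (emb (n := n) k j') = ∑ j ∈ inner (n := n) k, g j :=
  Finset.sum_nbij' (emb (n := n) k) (proj (n' := n') k) (fun j' _ => emb_mem_inner k hn hn' j') (fun _ _ => mem_univ _)
    (fun j' _ => proj_emb k hn hn' j') (fun _ hj => emb_proj k hn hn' hj) (fun _ _ => rfl)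

omit hN in
/-- **THE SMALL CHART'S DIRICHLET FORM IS THE INNER FORM OF THE BIG CHART.** [folklore] -/
theorem dirOn_shift (hn : 4 * k = n + 1) (hn' : 2 * k = n' + 1) (b : Tor N) (z : Tor N → ℂ) :
    dirOn (univ : Finset (Fin d → Fin (n' + 1))) (z ∘ chart N (n := n') (shift N k b))
      = dirOn (inner (n := n) k) (z ∘ chart N (n := n) b) := by
  rw [dirOn, dirOn]
  refine Finset.sum_congr rfl fun ν _ => ?_
  refine Finset.sum_nbij' (emb (n := n) k) (proj (n' := n') k) ?_ ?_ ?_ ?_ ?_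
  · intro j' hj'
    rw [mem_filter] at hj'
    have hne := hj'.2.1
    have hin := emb_mem_inner (n := n) k hn hn' j'
    rw [mem_filter]
    refine ⟨mem_univ _, ?_, hin, ?_⟩
    · intro h; have h1 := congrArg Fin.val h; rw [Fin.val_last, val_emb k hn hn'] at h1
      have h2 : (j' ν : ℕ) ≠ n' := fun e => hne (Fin.ext (by rw [e, Fin.val_last]))
      have := (j' ν).isLt; omega
    · rw [← emb_stepUp k hn hn' hne]; exact emb_mem_inner k hn hn' _
  · intro j hj
    rw [mem_filter] at hj
    obtain ⟨_, hne, hin, hin'⟩ := hj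
    rw [mem_filter]
    refine ⟨mem_univ _, ?_, mem_univ _, mem_univ _⟩
    intro h
    have h1 := congrArg Fin.val h
    rw [Fin.val_last, val_proj k hn hn' hin] at h1
    rw [mem_inner] at hin'
    have h2 := (hin' ν).2
    rw [val_stepUp hne] at h2
    rw [mem_inner] at hin
    have := (hin ν).1
    omega
  · intro j' _; exact proj_emb k hn hn' j'
  · intro j hj; rw [mem_filter] at hj; exact emb_proj k hn hn' hj.2.2.1
  · intro j' hj'
    rw [mem_filter] at hj'
    simp only [Function.comp]
    rw [← chart_emb N k hn hn', ← chart_emb N k hn hn', emb_stepUp k hn hn' hj'.2.1]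

omit hN in
/-- sums of a non-negative function over the small chart are at most those over the big chart. [folklore] -/
theorem sum_shift_le (hn : 4 * k = n + 1) (hn' : 2 * k = n' + 1) (b : Tor N) {G : Tor N → ℝ} (hG : ∀ x, 0 ≤ G x) :
    ∑ j' : Fin d → Fin (n' + 1), G (chart N (shift N k b) j') ≤ ∑ j : Fin d → Fin (n + 1), G (chart N b j) := by
  have h : ∑ j' : Fin d → Fin (n' + 1), G (chart N (shift N k b) j') = ∑ j ∈ inner (n := n) k, G (chart N b j) := by
    rw [← sum_emb k hn hn']
    exact Finset.sum_congr rfl fun j' _ => by rw [chart_emb N k hn hn']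
  rw [h]
  exact Finset.sum_le_sum_of_subset_of_nonneg (Finset.subset_univ _) fun _ _ _ => hG _

/-- the small chart's octant (parameter `k/2 = k'`, `2k' = k`) lies in the big chart's octant (parameter `k`). [folklore] -/
theorem emb_mem_oct (hn : 4 * k = n + 1) (hn' : 2 * k = n' + 1) {k' : ℕ} (hk' : 2 * k' = k) (σ : Fin d → Bool)
    {j' : Fin d → Fin (n' + 1)} (hj' : j' ∈ oct (n := n') k' σ) : emb (n := n) k j' ∈ oct (n := n) k σ := by
  rw [mem_oct] at hj' ⊢
  intro lam
  rw [val_emb k hn hn', ← hj' lam]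
  omega

end Emb

/-! ## §2 Morrey decay -/

/-- **MORREY DECAY OF THE DIRICHLET ENERGY AT A CORNER OF A VANISHING BLOCK** (Widman's hole-filling iterated over dyadic cubes).
`d ≥ 2`, `c ≠ 0`, `z` supported in `Ω`, `m ≥ 1`, `4m = n₀ + 1`.  For every `J` and every cube of side `4·2^J·m = n + 1 ≤ N ν` charted at `b`
whose `σ`-octant carries `z = 0`:
`dirOn univ (z ∘ chart (shift (2·2^J m − 2m) b)) ≤ θ_d^J·(dirOn univ (z ∘ chart b) + 64(1+2^d)(2^J m)²/‖c‖⁴·Σ_j ‖(1_ΩΔz)(chart b j)‖²)` —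
the cube of side `4m` with the same centre carries at most `θ_d^J` of the energy budget. [folklore] -/
theorem morrey_decay (hd : 2 ≤ d) {c : ℂ} (hc : c ≠ 0) {Ω : Tor N → Prop} [DecidablePred Ω] {z : Tor N → ℂ}
    (hz : ∀ x, ¬ Ω x → z x = 0) (σ : Fin d → Bool) {m : ℕ} (hm : 1 ≤ m) {n₀ : ℕ} (hn₀ : 4 * m = n₀ + 1) :
    ∀ (J : ℕ) {n : ℕ} (hn : 4 * (2 ^ J * m) = n + 1) (hN' : ∀ ν, n + 1 ≤ N ν) (b : Tor N)
      (hvan : ∀ j ∈ oct (n := n) (2 ^ J * m) σ, z (chart N b j) = 0),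
      dirOn (univ : Finset (Fin d → Fin (n₀ + 1))) (z ∘ chart N (n := n₀) (shift N (2 * 2 ^ J * m - 2 * m) b))
        ≤ theta d ^ J * (dirOn (univ : Finset (Fin d → Fin (n + 1))) (z ∘ chart N (n := n) b)
            + 64 * (1 + 2 ^ d) * ((2 ^ J * m : ℕ) : ℝ) ^ 2 / ‖c‖ ^ 4
              * ∑ j : Fin d → Fin (n + 1), ‖restrictTo Ω (LapS N c *ᵥ z) (chart N b j)‖ ^ 2) := by
  intro J
  induction J with
  | zero =>
    intro n hn hN' b hvan
    have hnn : n₀ = n := by rw [pow_zero, one_mul] at hn; omega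
    subst hnn
    rw [show 2 * 2 ^ 0 * m - 2 * m = 0 by simp, shift_zero, pow_zero (theta d), one_mul]
    exact le_add_of_nonneg_right (mul_nonneg (by positivity) (Finset.sum_nonneg fun _ _ => sq_nonneg _))
  | succ J ih =>
    intro n hn hN' b hvan
    -- the big scale: `K = 2^(J+1) m = 2K'`, `4K = n + 1`; the small scale: `4K' = 2K = n' + 1`
    set K := 2 ^ (J + 1) * m with hK
    set K' := 2 ^ J * m with hK'
    have hKK : K = 2 * K' := by rw [hK, hK', pow_succ]; ring
    have hK'pos : 1 ≤ K' := by rw [hK']; exact Nat.one_le_iff_ne_zero.mpr (by positivity)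
    have hK2 : 2 ≤ K := by omega
    obtain ⟨n', hn'⟩ : ∃ n', 2 * K = n' + 1 := ⟨2 * K - 1, by omega⟩
    have hn'K : 4 * (2 ^ J * m) = n' + 1 := by rw [← hK']; omega
    have hN'' : ∀ ν, n' + 1 ≤ N ν := fun ν => by have := hN' ν; omega
    -- one hole-filling step at the big scale
    have hstep := hole_filling_step N K b c z σ hd hK2 hn hN' hc hz hvan
    -- the inner form is the small chart's form; vanishing is inherited; the source sum only shrinks
    have hdir := dirOn_shift N K hn hn' b z
    have hvan' : ∀ j' ∈ oct (n := n') (2 ^ J * m) σ, z (chart N (shift N K b) j') = 0 := by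
      intro j' hj'
      rw [← chart_emb N K hn hn']
      exact hvan _ (emb_mem_oct K hn hn' (k' := 2 ^ J * m) (by rw [← hK']; omega) σ hj')
    have hih := ih hn'K hN'' (shift N K b) hvan'
    rw [shift_shift] at hih
    have hshift : K + (2 * 2 ^ J * m - 2 * m) = 2 * 2 ^ (J + 1) * m - 2 * m := by
      have hP1 : 2 * 2 ^ J * m = 2 * K' := by rw [hK']; ring
      have hP2 : 2 * 2 ^ (J + 1) * m = 4 * K' := by rw [hK', pow_succ]; ring
      have hmK : m ≤ K' := by rw [hK']; exact Nat.le_mul_of_pos_left m (by positivity)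
      rw [hP1, hP2, hKK]; omega
    rw [hshift] at hih
    have hsrc := sum_shift_le N K hn hn' b (G := fun x => ‖restrictTo Ω (LapS N c *ᵥ z) x‖ ^ 2) (fun _ => sq_nonneg _)
    -- bookkeeping: `θ^J·(θ·a + 16C K² M + 64C K'² M) ≤ θ^(J+1)·(a + 64C K² M)` because `θ ≥ ½`, `K = 2K'`
    set a := dirOn (univ : Finset (Fin d → Fin (n + 1))) (z ∘ chart N (n := n) b) with ha
    set M := ∑ j : Fin d → Fin (n + 1), ‖restrictTo Ω (LapS N c *ᵥ z) (chart N b j)‖ ^ 2 with hM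
    set M' := ∑ j' : Fin d → Fin (n' + 1), ‖restrictTo Ω (LapS N c *ᵥ z) (chart N (shift N K b) j')‖ ^ 2 with hM'
    set a' := dirOn (univ : Finset (Fin d → Fin (n' + 1))) (z ∘ chart N (n := n') (shift N K b)) with ha'
    have hθ := theta_lt_one d
    have hθ0 : 0 ≤ theta d := by linarith [hθ.1]
    have hθJ : 0 ≤ theta d ^ J := pow_nonneg hθ0 J
    have hM0 : 0 ≤ M := Finset.sum_nonneg fun _ _ => sq_nonneg _
    have hM'0 : 0 ≤ M' := Finset.sum_nonneg fun _ _ => sq_nonneg _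
    have hcpos : 0 < ‖c‖ := norm_pos_iff.mpr hc
    have hKr : ((K : ℕ) : ℝ) = 2 * ((K' : ℕ) : ℝ) := by rw [hKK]; push_cast; ring
    have hcoef : 0 ≤ 64 * (1 + 2 ^ d) * ((K' : ℕ) : ℝ) ^ 2 / ‖c‖ ^ 4 := by positivity
    have hcoef2 : 0 ≤ 16 * (1 + 2 ^ d) * ((K : ℕ) : ℝ) ^ 2 / ‖c‖ ^ 4 := by positivity
    rw [← hdir] at hstep
    -- `a₀ ≤ θ^J (a' + 64 C K'² M')`, `a' ≤ θ a + 16 C K² M`, `M' ≤ M`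
    calc dirOn univ (z ∘ chart N (shift N (2 * 2 ^ (J + 1) * m - 2 * m) b))
        ≤ theta d ^ J * (a' + 64 * (1 + 2 ^ d) * ((K' : ℕ) : ℝ) ^ 2 / ‖c‖ ^ 4 * M') := hih
      _ ≤ theta d ^ J * ((theta d * a + 16 * (1 + 2 ^ d) * ((K : ℕ) : ℝ) ^ 2 / ‖c‖ ^ 4 * M)
            + 64 * (1 + 2 ^ d) * ((K' : ℕ) : ℝ) ^ 2 / ‖c‖ ^ 4 * M) := by
          refine mul_le_mul_of_nonneg_left (add_le_add hstep (mul_le_mul_of_nonneg_left hsrc hcoef)) hθJ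
      _ ≤ theta d ^ (J + 1) * (a + 64 * (1 + 2 ^ d) * ((K : ℕ) : ℝ) ^ 2 / ‖c‖ ^ 4 * M) := by
          rw [pow_succ (theta d) J]
          have hkey : 16 * (1 + 2 ^ d) * ((K : ℕ) : ℝ) ^ 2 / ‖c‖ ^ 4 * M + 64 * (1 + 2 ^ d) * ((K' : ℕ) : ℝ) ^ 2 / ‖c‖ ^ 4 * M
              ≤ theta d * (64 * (1 + 2 ^ d) * ((K : ℕ) : ℝ) ^ 2 / ‖c‖ ^ 4 * M) := by
            rw [hKr]
            have hM1 : 0 ≤ (1 + 2 ^ d) * ((K' : ℕ) : ℝ) ^ 2 / ‖c‖ ^ 4 * M := mul_nonneg (by positivity) hM0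
            have e1 : 16 * (1 + 2 ^ d) * (2 * ((K' : ℕ) : ℝ)) ^ 2 / ‖c‖ ^ 4 * M + 64 * (1 + 2 ^ d) * ((K' : ℕ) : ℝ) ^ 2 / ‖c‖ ^ 4 * M
                = 128 * ((1 + 2 ^ d) * ((K' : ℕ) : ℝ) ^ 2 / ‖c‖ ^ 4 * M) := by ring
            have e2 : theta d * (64 * (1 + 2 ^ d) * (2 * ((K' : ℕ) : ℝ)) ^ 2 / ‖c‖ ^ 4 * M)
                = (256 * theta d) * ((1 + 2 ^ d) * ((K' : ℕ) : ℝ) ^ 2 / ‖c‖ ^ 4 * M) := by ring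
            rw [e1, e2]
            exact mul_le_mul_of_nonneg_right (by linarith [hθ.1]) hM1
          have h := mul_le_mul_of_nonneg_left hkey hθJ
          nlinarith [h]

end Summit.QuantumFields.BalabanUV.T4Continuum.DirichletMorreyDecay

end
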